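import Literature.MathematicalPhysics.QuantumFieldTheory.Balaban1983to89.B11Eq103H1Complex

/-!
# `Balaban1983to89.B9Eq38CovDivSliceGradient` — T. Bałaban, *Propagators for lattice gauge theories in a background field*, Commun. Math. Phys. **99**
# (1985) 389–434 [Balaban1985BackgroundPropagators] (3.8) p. 392 (the adjoint covariant derivative `D*_U` on bond functions), (3.3) pp. 390–391 (the
# covariant derivative `D_U` on site functions), (3.26) p. 395 (the local part `A₀ = Δ(U) + D_UD*_U + aQ*Q` of `Δ_a`), Thm 3.1 (3.42) p. 397 (second entry,
# the covariant-gradient row): **THE COVARIANT DIVERGENCE OF A BOND FIELD IS MINUS THE SUM OF THE ADJOINT-TRANSPORTED BACKWARD SLICE DERIVATIVES —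
# `(D*_U A)(y) = −Σ_μ S(y − e_μ, μ)·(D_U A_μ)(y − e_μ, μ)` with `A_μ = A(·, μ)` the μ-SLICE (a site function) — SO A GRADIENT ROW FOR EVERY SLICE OF `u = A₀⁻¹f`
# (storey J per slice: `B9Eq326LocalPartSliceEquation` + `B9Eq342GradientRowAssembly` §5) IS A ROW FOR `D*_U A₀⁻¹ f` IN THE SAME WEIGHTED CURRENCY, with the
# constant `Σ_μ ρ_μ·B_μ` (the OWNER's plan v11 §2 (ii), `t4/b2b-balaban-t4-ne9-p1/g91/PLAN-V11-STOREY-G1.md`: the letter of `D*_UA₀⁻¹`, bonds → sites)**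

statement-level skeleton of published theorems with citation tags; proofs where landed; nothing here is a claim about the Yang–Mills mass gap

CITATION HEADER (lean-in-tree rule).  Audit cell `pub-balaban`, sub-cell `t4`, BINDER row NE9; filed by NE9 crux-team LEAF PROVER 05
(`b2b-balaban-t4-ne9-formalise-leaf-05`, gen 85).  SOURCE READ first-hand in the held text layer [Balaban1985BackgroundPropagators]
(`paper:balaban1985-cmp99-background-propagators`): p. 392 (3.8) `(D*A)(x) = Σ_μ η⁻¹(R(U(x, x − ηe_μ))A(x − ηe_μ, x) − A(x, x + ηe_μ))`; pp. 390–391 (3.3)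
`(D^η_U λ)(b) = η⁻¹(R(U(b))λ(b₊) − λ(b₋))`; p. 395 (3.26); p. 397 Thm 3.1 (3.42).  The identity below is print's (3.8) REGROUPED: for the bond
`b = ⟨x − e_μ, x⟩ = (x − e_μ, μ)` one has `R(U(b))⁻¹·(D_Uλ)(b) = η⁻¹(λ(x) − R(U(b))⁻¹λ(x − e_μ))`, i.e. minus the μ-th summand of (3.8) at `λ = A_μ` — [folklore]
lattice algebra (one line) and the triangle inequality; nothing printed is a hypothesis; the `[cite: …]` tags are TEXT LOCATIONS.  It is typed because the
OWNER's plan v11 §2 (ii) needs the row of `D*_UA₀⁻¹` and the cell's storey J (`B9Eq342GradientRowAssembly`, this lineage g84) delivers gradient rows of SITE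
equations — `B9Eq326LocalPartSliceEquation` (this lineage g84, tree) reads `A₀u = f` slice by slice as such site equations; this file closes the triangle
`slices ⟶ divergence` (successor memo `t4/b2b-balaban-t4-ne9-formalise-leaf-05/g84/V28-NEXT.md` item 3 (d)).

WHAT IS PROVED (sorry-free; 0 `def`; [folklore]).  Transporter data `R S : Bond d Pd → V →ₗ V` with `S(b)R(b) = 1` (`hSR`; for print's `R = Ad U`,
`S = Ad U⁻¹`), constant `c` (= η⁻¹), a bond field `A`; its μ-slice is the site field `x ↦ A(x, μ)` (no `def`: written inline; in `BondL2K` it is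
`(WL2.equiv).symm (fun x ↦ A(x, μ))`, the object of `B9Eq326LocalPartSliceEquation`).
* §1 **`apply_covDeriv_slice_unshift`** — `S(y − e_μ, μ)·(D A_μ)(y − e_μ, μ) = c•(A(y, μ) − S(y − e_μ, μ)A(y − e_μ, μ))`;
  **`covDiv_eq_neg_sum_slice`** — `(D*A)(y) = −Σ_μ S(y − e_μ, μ)·(D A_μ)(y − e_μ, μ)` (any commutative ring of scalars, any module fibre).
* §2 **`norm_covDiv_le_sum_slice`** — contracting `S` (`‖S(b)w‖ ≤ ‖w‖`): `‖(D*A)(y)‖ ≤ Σ_μ ‖(D A_μ)(y − e_μ, μ)‖`;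
  **`norm_covDiv_le_weighted_of_slice_rows`** — if every slice has a gradient row in the weighted currency of `B9Eq342GradientRowAssembly`
  (`‖(D A_μ)(b)‖ ≤ ρ_μ·(B_{b.2}·W(b₊))` for all bonds `b`, any weight `W` on sites and direction constants `B_ν`), then `‖(D*A)(y)‖ ≤ (Σ_μ ρ_μ·B_μ)·W(y)` —
  the bonds INTO `y` have target `y`, so NO one-step weight ratio is paid.
* §3 the same read in the `L²` carriers of the chain (`covDivL2K`, `covDerivL2K` through `WL2.equiv`): **`equiv_covDivL2K_eq_neg_sum_slice`**,
  **`norm_equiv_covDivL2K_le_sum_slice`**, **`norm_equiv_covDivL2K_le_weighted_of_slice_rows`** — the last one's hypothesis is LITERALLY the conclusion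
  shape of `B9Eq342GradientRowAssembly.norm_covDeriv_le_weighted_of_letters(_penalty)` at the slice `(WL2.equiv).symm (fun x ↦ u(x, μ))`.
HONEST SCOPE.  Algebra + triangle inequality; the slice ROWS `ρ_μ` are hypotheses (their suppliers: storey J per slice, with the weighted value rows of
`u = A₀⁻¹f` and of the order-zero part `(A₀ − L_K)u` as THEIR displayed letters); the transposed row `A₀⁻¹D_U` (sites → bonds) is NOT here (it is the
`L²`-adjoint of this one for the symmetric `A₀` — ne9-leaf-03's `B9Eq347LocalLetterAdjoint.local_adjoint` in the block currency, or a direct pointwise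
reading); nothing of [B9] Thm 3.1∕3.3 is asserted, valued or discharged.  NOT NE9 (cell pub-balaban: NE9 NOT PRINTED ∕ NOT PROVED; «NE9 ⇐ the named
binders»; row WALLED ON A MODEL (O-NE9-1; #5 UNRULED); spine PROVED 0∕9; rung (B)+1 on a finite T⁴ — NOT infinite volume, NOT mass gap, NOT Clay; HONEST
DEPENDENCY: continuum YM on T⁴ ⇐ BetaPertH ∧ nine spine estimates (0/9 proved); BetaPertH ⇐ (D1) ∧ (D4) ∧ CAP+tail; G-an2-4 gates asym, D1 and NE2/3/4).
NEW file importing `B11Eq103H1Complex` only; nothing modified.  Net new unproved facts: 0.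
-/

noncomputable section

set_option autoImplicit false

open scoped BigOperators

namespace Literature.MathematicalPhysics.QuantumFieldTheory.Balaban1983to89.B9Eq38CovDivSliceGradient

open B4Sect5Torus (TSite)
open B9SectCLatticeCarrier (Bond bpos btgt shift unshift shift_unshift)
open B9Eq33CovDerivVector (covDeriv covDiv covDeriv_apply_dir covDiv_apply)
open B9Eq311L2Pairing (WL2)
open B11Eq103H1Complex (SiteL2K BondL2K covDerivL2K covDivL2K equiv_covDerivL2K equiv_covDivL2K)

/-! ## §1 (3.8) as minus the sum of the adjoint-transported backward slice derivatives (3.3) -/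

section Identity

variable {d : ℕ} {Pd : Fin d → ℕ} {𝕜 : Type*} [CommRing 𝕜] {V : Type*} [AddCommGroup V] [Module 𝕜 V]

/-- **The μ-th summand of (3.8) is a transported backward slice derivative**: for the bond `(y − e_μ, μ)` (from `y − e_μ` into `y`) and `S(b)R(b) = 1`,
`S(y − e_μ, μ)·(D A_μ)(y − e_μ, μ) = c•(A(y, μ) − S(y − e_μ, μ)·A(y − e_μ, μ))`, `A_μ = A(·, μ)`. [folklore]
[cite: Balaban1985BackgroundPropagators, (3.3) pp.390–391, (3.8) p.392] -/
theorem apply_covDeriv_slice_unshift (c : 𝕜) (R S : Bond d Pd → V →ₗ[𝕜] V) (hSR : ∀ b w, S b (R b w) = w) (A : Bond d Pd → V)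
    (y : TSite d Pd) (μ : Fin d) :
    S (unshift μ y, μ) (covDeriv c R (fun x => A (x, μ)) (unshift μ y, μ)) = c • (A (y, μ) - S (unshift μ y, μ) (A (unshift μ y, μ))) := by
  rw [covDeriv_apply_dir, shift_unshift, map_smul, map_sub, hSR]

/-- **`(D*_U A)(y) = −Σ_μ S(y − e_μ, μ)·(D_U A_μ)(y − e_μ, μ)`** — the covariant divergence (3.8) of a bond field is minus the sum, over the `d` bonds INTO
`y`, of the adjoint-transported covariant derivatives (3.3) of its slices. [folklore] [cite: Balaban1985BackgroundPropagators, (3.8) p.392, (3.3) pp.390–391] -/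
theorem covDiv_eq_neg_sum_slice (c : 𝕜) (R S : Bond d Pd → V →ₗ[𝕜] V) (hSR : ∀ b w, S b (R b w) = w) (A : Bond d Pd → V) (y : TSite d Pd) :
    covDiv c S A y = -∑ μ, S (unshift μ y, μ) (covDeriv c R (fun x => A (x, μ)) (unshift μ y, μ)) := by
  rw [covDiv_apply, Finset.smul_sum, ← Finset.sum_neg_distrib]
  refine Finset.sum_congr rfl fun μ _ => ?_
  rw [apply_covDeriv_slice_unshift c R S hSR A y μ, smul_sub, smul_sub, neg_sub]

end Identity

/-! ## §2 The divergence row from the slice gradient rows -/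

section Norm

variable {d : ℕ} {Pd : Fin d → ℕ} {𝕜 : Type*} [RCLike 𝕜] {V : Type*} [NormedAddCommGroup V] [NormedSpace 𝕜 V]

/-- **`‖(D*_U A)(y)‖ ≤ Σ_μ ‖(D_U A_μ)(y − e_μ, μ)‖`** for contracting adjoint transporters (`‖S(b)w‖ ≤ ‖w‖`, `S(b)R(b) = 1`). [folklore]
[cite: Balaban1985BackgroundPropagators, (3.8) p.392, (3.3) pp.390–391] -/
theorem norm_covDiv_le_sum_slice (c : 𝕜) (R S : Bond d Pd → V →ₗ[𝕜] V) (hSR : ∀ b w, S b (R b w) = w) (hSc : ∀ b w, ‖S b w‖ ≤ ‖w‖)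
    (A : Bond d Pd → V) (y : TSite d Pd) :
    ‖covDiv c S A y‖ ≤ ∑ μ, ‖covDeriv c R (fun x => A (x, μ)) (unshift μ y, μ)‖ := by
  rw [covDiv_eq_neg_sum_slice c R S hSR A y, norm_neg]
  exact (norm_sum_le _ _).trans (Finset.sum_le_sum fun μ _ => hSc _ _)

/-- **THE DIVERGENCE ROW FROM THE SLICE GRADIENT ROWS (weighted currency of storey J).**  If every slice `A_μ` has a gradient row
`‖(D_U A_μ)(b)‖ ≤ ρ_μ·(B_{b.2}·W(b₊))` at ALL bonds `b` (any site weight `W`, any direction constants `B_ν` — the conclusion shape of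
`B9Eq342GradientRowAssembly`), then `‖(D*_U A)(y)‖ ≤ (Σ_μ ρ_μ·B_μ)·W(y)`: the bond `(y − e_μ, μ)` has target `y`, so the weight is read AT `y`. [folklore]
[cite: Balaban1985BackgroundPropagators, (3.8) p.392, Thm 3.1 (3.42) p.397, (3.26) p.395] -/
theorem norm_covDiv_le_weighted_of_slice_rows (c : 𝕜) (R S : Bond d Pd → V →ₗ[𝕜] V) (hSR : ∀ b w, S b (R b w) = w)
    (hSc : ∀ b w, ‖S b w‖ ≤ ‖w‖) (A : Bond d Pd → V) (Wt : TSite d Pd → ℝ) (B ρ : Fin d → ℝ)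
    (hrow : ∀ (μ : Fin d) (b : Bond d Pd), ‖covDeriv c R (fun x => A (x, μ)) b‖ ≤ ρ μ * (B b.2 * Wt (btgt b))) (y : TSite d Pd) :
    ‖covDiv c S A y‖ ≤ (∑ μ, ρ μ * B μ) * Wt y := by
  refine (norm_covDiv_le_sum_slice c R S hSR hSc A y).trans ?_
  rw [Finset.sum_mul]
  refine Finset.sum_le_sum fun μ _ => ?_
  have h := hrow μ (unshift μ y, μ)
  have e : btgt ((unshift μ y, μ) : Bond d Pd) = y := shift_unshift μ y
  rw [e] at h
  exact h.trans (le_of_eq (by ring))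

end Norm

/-! ## §3 The same in the `L²` carriers of the chain -/

section L2

variable {𝕜 : Type*} [RCLike 𝕜] {d : ℕ} {Pd : Fin d → ℕ} {W : Type*} [NormedAddCommGroup W] [InnerProductSpace 𝕜 W] {c₀ : ℝ} [Fact (0 < c₀)]

/-- **(3.8) through the identifications**: `(D*_U u)(y) = −Σ_μ S(y − e_μ, μ)·(D_U u_μ)(y − e_μ, μ)` with `D*_U = covDivL2K`, `D_U = covDerivL2K` and the
slice `u_μ = (WL2.equiv).symm (fun x ↦ u(x, μ))` of `B9Eq326LocalPartSliceEquation`. [folklore] [cite: Balaban1985BackgroundPropagators, (3.8) p.392, (3.3) pp.390–391] -/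
theorem equiv_covDivL2K_eq_neg_sum_slice (c : 𝕜) (R S : Bond d Pd → W →ₗ[𝕜] W) (hSR : ∀ b w, S b (R b w) = w) (u : BondL2K 𝕜 d Pd c₀ W)
    (y : TSite d Pd) :
    WL2.equiv 𝕜 _ W (covDivL2K 𝕜 c₀ c S u) y =
      -∑ μ, S (unshift μ y, μ) (WL2.equiv 𝕜 _ W (covDerivL2K 𝕜 c₀ c R
        ((WL2.equiv 𝕜 (fun _ : TSite d Pd => c₀) W).symm fun x => WL2.equiv 𝕜 _ W u (x, μ))) (unshift μ y, μ)) := by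
  rw [equiv_covDivL2K, covDiv_eq_neg_sum_slice c R S hSR]
  refine congrArg Neg.neg (Finset.sum_congr rfl fun μ _ => ?_)
  rw [equiv_covDerivL2K, Equiv.apply_symm_apply]

/-- **`‖(D*_U u)(y)‖ ≤ Σ_μ ‖(D_U u_μ)(y − e_μ, μ)‖`** in the `L²` carriers, contracting `S`. [folklore]
[cite: Balaban1985BackgroundPropagators, (3.8) p.392, (3.3) pp.390–391] -/
theorem norm_equiv_covDivL2K_le_sum_slice (c : 𝕜) (R S : Bond d Pd → W →ₗ[𝕜] W) (hSR : ∀ b w, S b (R b w) = w) (hSc : ∀ b w, ‖S b w‖ ≤ ‖w‖)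
    (u : BondL2K 𝕜 d Pd c₀ W) (y : TSite d Pd) :
    ‖WL2.equiv 𝕜 _ W (covDivL2K 𝕜 c₀ c S u) y‖ ≤
      ∑ μ, ‖WL2.equiv 𝕜 _ W (covDerivL2K 𝕜 c₀ c R
        ((WL2.equiv 𝕜 (fun _ : TSite d Pd => c₀) W).symm fun x => WL2.equiv 𝕜 _ W u (x, μ))) (unshift μ y, μ)‖ := by
  rw [equiv_covDivL2K_eq_neg_sum_slice c R S hSR u y, norm_neg]
  exact (norm_sum_le _ _).trans (Finset.sum_le_sum fun μ _ => hSc _ _)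

/-- **THE ROW OF `D*_U A₀⁻¹`-TYPE OBJECTS FROM STOREY J PER SLICE.**  If for every direction `μ` the slice `u_μ = (WL2.equiv).symm (fun x ↦ u(x, μ))` has the
gradient row `‖(D_U u_μ)(b)‖ ≤ ρ_μ·(B_{b.2}·W(b₊))` at all bonds (LITERALLY the conclusion of `B9Eq342GradientRowAssembly.norm_covDeriv_le_weighted_of_letters_penalty`
with its hypotheses supplied by `B9Eq326LocalPartSliceEquation.slice_equation` ∕ `norm_slice_data_le` for `u = A₀⁻¹f`), then
`‖(D*_U u)(y)‖ ≤ (Σ_μ ρ_μ·B_μ)·W(y)` for every site `y`. [folklore] [cite: Balaban1985BackgroundPropagators, (3.8) p.392, (3.26) p.395, Thm 3.1 (3.42) p.397] -/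
theorem norm_equiv_covDivL2K_le_weighted_of_slice_rows (c : 𝕜) (R S : Bond d Pd → W →ₗ[𝕜] W) (hSR : ∀ b w, S b (R b w) = w)
    (hSc : ∀ b w, ‖S b w‖ ≤ ‖w‖) (u : BondL2K 𝕜 d Pd c₀ W) (Wt : TSite d Pd → ℝ) (B ρ : Fin d → ℝ)
    (hrow : ∀ (μ : Fin d) (b : Bond d Pd), ‖WL2.equiv 𝕜 _ W (covDerivL2K 𝕜 c₀ c R
      ((WL2.equiv 𝕜 (fun _ : TSite d Pd => c₀) W).symm fun x => WL2.equiv 𝕜 _ W u (x, μ))) b‖ ≤ ρ μ * (B b.2 * Wt (btgt b)))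
    (y : TSite d Pd) :
    ‖WL2.equiv 𝕜 _ W (covDivL2K 𝕜 c₀ c S u) y‖ ≤ (∑ μ, ρ μ * B μ) * Wt y := by
  rw [equiv_covDivL2K]
  refine norm_covDiv_le_weighted_of_slice_rows c R S hSR hSc (WL2.equiv 𝕜 _ W u) Wt B ρ (fun μ b => ?_) y
  have h := hrow μ b
  rwa [equiv_covDerivL2K, Equiv.apply_symm_apply] at h

end L2

end Literature.MathematicalPhysics.QuantumFieldTheory.Balaban1983to89.B9Eq38CovDivSliceGradient

end
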